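import Summits.FinalStateConjecture.FinalStateConjecture.Theorems.EIHFluxBalanceInertialRecessionSlavingRadiusHessian

/-!
# Route EIHFluxBalance — `InertialRecession` (E′), stub `stub_frozenVacuumSlaving` (K1): SECOND partials of
# the Kerr–Schild null covector components (general quotient-rule formulas; tables at tangent points)

Helper file for the crux `stmt-FinalStateConjecture-17403` (2-jet tables, part 2). From the closed forms of the
first derivatives `∂_v ℓ_μ` (`…SlavingAxisData.fderiv_nullCovectorFun_one/two/three`, valid on `{r > 0}`) the
quotient rule along the line `t ↦ y + t w` gives `∂_w ∂_v ℓ_μ` in terms of `r, ∂_v r, ∂_w r, ∂_w∂_v r` and the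
coordinates (`fderiv_fderiv_nullCovectorFun_three/one/two`). At a tangent point `(t, x, a, 0)` (with the radius tables
of `…SlavingTangentData` / `…SlavingRadiusHessian`): `∂₂₂ℓ₁ = ∂₃₃ℓ₁ = −1/x²`; `∂₁₂ℓ₂ = −1/x²`, `∂₂₂ℓ₂ = −a/x³`,
`∂₃₃ℓ₂ = a/x³`; `∂₁₃ℓ₃ = −1/x²`, `∂₂₃ℓ₃ = −a/x³`; all other spatial second partials of `ℓ₁, ℓ₂, ℓ₃` vanish
(`ℓ₀ ≡ 1`). No definitions, no `sorry`. [folklore]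
-/

set_option linter.dupNamespace false

noncomputable section

open scoped Topology
open Filter Set Function Literature.Geometry.Lorentzian Literature.Geometry.Lorentzian.Kerr

namespace Summit.FinalStateConjecture.FinalStateConjecture.Theorems.SublinearIsFree.Slaving

section General

variable {a : ℝ} {y : E4} (hy : 0 < radius a y)
include hy

/-- `z ↦ ∂_v ℓ_μ(z)` is differentiable wherever `r > 0`. [folklore] -/
theorem differentiableAt_fderiv_nullCovectorFun_apply (μ : Fin 4) (v : E4) :
    DifferentiableAt ℝ (fun z ↦ fderiv ℝ (fun x ↦ nullCovectorFun a x μ) z v) y := by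
  have h2 : ContDiffAt ℝ 2 (fun x ↦ nullCovectorFun a x μ) y := contDiffAt_nullCovectorFun a hy μ
  have h1 : ContDiffAt ℝ 1 (fderiv ℝ (fun x ↦ nullCovectorFun a x μ)) y := h2.fderiv_right (m := 1) (by norm_num)
  exact ((ContinuousLinearMap.apply ℝ ℝ v).contDiff.contDiffAt.comp y h1).differentiableAt one_ne_zero

/-- Points of the line `t ↦ y + t w` near `t = 0` have positive radius. [folklore] -/
theorem eventually_radius_pos_line (w : E4) : ∀ᶠ t : ℝ in 𝓝 0, 0 < radius a (y + t • w) := by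
  have hopen : IsOpen {z : E4 | 0 < radius a z} := isOpen_lt continuous_const (continuous_radius a)
  have hline : Continuous (fun t : ℝ ↦ y + t • w) := by fun_prop
  exact hline.continuousAt.preimage_mem_nhds (hopen.mem_nhds (by simpa using hy))

/-- The line derivative of `t ↦ ∂_v r(y + t w)` is the second partial `∂_w∂_v r`. [folklore] -/
theorem hasDerivAt_fderiv_radius_line (v w : E4) :
    HasDerivAt (fun t : ℝ ↦ fderiv ℝ (radius a) (y + t • w) v)
      (fderiv ℝ (fun z ↦ fderiv ℝ (radius a) z v) y w) 0 :=
  (differentiableAt_fderiv_radius_apply hy v).hasFDerivAt.hasLineDerivAt w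

/-- **`∂_w∂_v ℓ₃`** (`ℓ₃ = x³/r`): with `r_v = ∂_v r`, `r_w`, `r_vw = ∂_w∂_v r`,
`∂_w∂_v ℓ₃ = ((v³ r_w − (w³ r_v + x³ r_vw)) r² − (v³ r − x³ r_v)(2 r r_w))/r⁴`. [folklore] -/
theorem fderiv_fderiv_nullCovectorFun_three (v w : E4) :
    fderiv ℝ (fun z ↦ fderiv ℝ (fun x ↦ nullCovectorFun a x 3) z v) y w =
      ((v 3 * fderiv ℝ (radius a) y w - (w 3 * fderiv ℝ (radius a) y v +
            y 3 * fderiv ℝ (fun z ↦ fderiv ℝ (radius a) z v) y w)) * radius a y ^ 2 -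
          (v 3 * radius a y - y 3 * fderiv ℝ (radius a) y v) * (2 * radius a y * fderiv ℝ (radius a) y w)) /
        (radius a y ^ 2) ^ 2 := by
  have hd := differentiableAt_fderiv_nullCovectorFun_apply hy 3 v
  refine (hd.hasFDerivAt.hasLineDerivAt w).unique ?_
  show HasDerivAt (fun t : ℝ ↦ fderiv ℝ (fun x ↦ nullCovectorFun a x 3) (y + t • w) v) _ 0
  have hfun : (fun t : ℝ ↦ fderiv ℝ (fun x ↦ nullCovectorFun a x 3) (y + t • w) v) =ᶠ[𝓝 0]
      fun t ↦ (v 3 * radius a (y + t • w) - (y 3 + t * w 3) * fderiv ℝ (radius a) (y + t • w) v) /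
        radius a (y + t • w) ^ 2 := by
    filter_upwards [eventually_radius_pos_line hy w] with t ht
    rw [fderiv_nullCovectorFun_three ht v, add_smul_apply_E4]
  refine HasDerivAt.congr_of_eventuallyEq ?_ hfun
  have hr := hasDerivAt_radius_line hy w
  have hrv := hasDerivAt_fderiv_radius_line hy v w
  have hN := (hr.const_mul (v 3)).sub
    ((((hasDerivAt_id (0 : ℝ)).mul_const (w 3)).const_add (y 3)).mul hrv)
  have hD := hr.pow 2
  have hD0 : radius a (y + (0 : ℝ) • w) ^ 2 ≠ 0 := by simpa using (pow_pos hy 2).ne'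
  have hdiv := hN.div hD hD0
  refine hdiv.congr_deriv ?_
  simp only [Pi.pow_apply, Pi.mul_apply, Pi.sub_apply, zero_smul, add_zero, zero_mul, Nat.cast_ofNat, one_mul,
    pow_one, Nat.add_one_sub_one, id_eq]

/-- **`∂_w∂_v ℓ₁`** (`ℓ₁ = (r x¹ + a x²)/(r² + a²)`), quotient rule on the closed form of `∂_v ℓ₁`. [folklore] -/
theorem fderiv_fderiv_nullCovectorFun_one (v w : E4) :
    fderiv ℝ (fun z ↦ fderiv ℝ (fun x ↦ nullCovectorFun a x 1) z v) y w =
      (((fderiv ℝ (fun z ↦ fderiv ℝ (radius a) z v) y w * y 1 + fderiv ℝ (radius a) y v * w 1 +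
              fderiv ℝ (radius a) y w * v 1) * (radius a y ^ 2 + a ^ 2) +
            (fderiv ℝ (radius a) y v * y 1 + radius a y * v 1 + a * v 2) *
              (2 * radius a y * fderiv ℝ (radius a) y w) -
          ((fderiv ℝ (radius a) y w * y 1 + radius a y * w 1 + a * w 2) *
              (2 * radius a y * fderiv ℝ (radius a) y v) +
            (radius a y * y 1 + a * y 2) * (2 * fderiv ℝ (radius a) y w * fderiv ℝ (radius a) y v +
              2 * radius a y * fderiv ℝ (fun z ↦ fderiv ℝ (radius a) z v) y w))) *
          (radius a y ^ 2 + a ^ 2) ^ 2 -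
        ((fderiv ℝ (radius a) y v * y 1 + radius a y * v 1 + a * v 2) * (radius a y ^ 2 + a ^ 2) -
            (radius a y * y 1 + a * y 2) * (2 * radius a y * fderiv ℝ (radius a) y v)) *
          (2 * (radius a y ^ 2 + a ^ 2) * (2 * radius a y * fderiv ℝ (radius a) y w))) /
      ((radius a y ^ 2 + a ^ 2) ^ 2) ^ 2 := by
  have hd := differentiableAt_fderiv_nullCovectorFun_apply hy 1 v
  refine (hd.hasFDerivAt.hasLineDerivAt w).unique ?_
  show HasDerivAt (fun t : ℝ ↦ fderiv ℝ (fun x ↦ nullCovectorFun a x 1) (y + t • w) v) _ 0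
  have hfun : (fun t : ℝ ↦ fderiv ℝ (fun x ↦ nullCovectorFun a x 1) (y + t • w) v) =ᶠ[𝓝 0]
      fun t ↦ ((fderiv ℝ (radius a) (y + t • w) v * (y 1 + t * w 1) + radius a (y + t • w) * v 1 + a * v 2) *
            (radius a (y + t • w) ^ 2 + a ^ 2) -
          (radius a (y + t • w) * (y 1 + t * w 1) + a * (y 2 + t * w 2)) *
            (2 * radius a (y + t • w) * fderiv ℝ (radius a) (y + t • w) v)) /
        (radius a (y + t • w) ^ 2 + a ^ 2) ^ 2 := by
    filter_upwards [eventually_radius_pos_line hy w] with t ht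
    rw [fderiv_nullCovectorFun_one ht v, add_smul_apply_E4, add_smul_apply_E4]
  refine HasDerivAt.congr_of_eventuallyEq ?_ hfun
  have hr := hasDerivAt_radius_line hy w
  have hrv := hasDerivAt_fderiv_radius_line hy v w
  have hl1 := ((hasDerivAt_id (0 : ℝ)).mul_const (w 1)).const_add (y 1)
  have hl2 := ((hasDerivAt_id (0 : ℝ)).mul_const (w 2)).const_add (y 2)
  have hA := ((hrv.mul hl1).add (hr.mul_const (v 1))).add_const (a * v 2)
  have hP := (hr.pow 2).add_const (a ^ 2)
  have hB := (hr.mul hl1).add (hl2.const_mul a)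
  have hC := (hr.const_mul 2).mul hrv
  have hN := (hA.mul hP).sub (hB.mul hC)
  have hD := hP.pow 2
  have hQ : radius a y ^ 2 + a ^ 2 ≠ 0 := by positivity
  have hD0 : (radius a (y + (0 : ℝ) • w) ^ 2 + a ^ 2) ^ 2 ≠ 0 := by simpa using pow_ne_zero 2 hQ
  have hdiv := hN.div hD hD0
  refine hdiv.congr_deriv ?_
  simp only [Pi.pow_apply, Pi.mul_apply, Pi.sub_apply, Pi.add_apply, zero_smul, add_zero, zero_mul,
    Nat.cast_ofNat, one_mul, pow_one, Nat.add_one_sub_one, id_eq]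

/-- **`∂_w∂_v ℓ₂`** (`ℓ₂ = (r x² − a x¹)/(r² + a²)`), quotient rule on the closed form of `∂_v ℓ₂`. [folklore] -/
theorem fderiv_fderiv_nullCovectorFun_two (v w : E4) :
    fderiv ℝ (fun z ↦ fderiv ℝ (fun x ↦ nullCovectorFun a x 2) z v) y w =
      (((fderiv ℝ (fun z ↦ fderiv ℝ (radius a) z v) y w * y 2 + fderiv ℝ (radius a) y v * w 2 +
              fderiv ℝ (radius a) y w * v 2) * (radius a y ^ 2 + a ^ 2) +
            (fderiv ℝ (radius a) y v * y 2 + radius a y * v 2 - a * v 1) *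
              (2 * radius a y * fderiv ℝ (radius a) y w) -
          ((fderiv ℝ (radius a) y w * y 2 + radius a y * w 2 - a * w 1) *
              (2 * radius a y * fderiv ℝ (radius a) y v) +
            (radius a y * y 2 - a * y 1) * (2 * fderiv ℝ (radius a) y w * fderiv ℝ (radius a) y v +
              2 * radius a y * fderiv ℝ (fun z ↦ fderiv ℝ (radius a) z v) y w))) *
          (radius a y ^ 2 + a ^ 2) ^ 2 -
        ((fderiv ℝ (radius a) y v * y 2 + radius a y * v 2 - a * v 1) * (radius a y ^ 2 + a ^ 2) -
            (radius a y * y 2 - a * y 1) * (2 * radius a y * fderiv ℝ (radius a) y v)) *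
          (2 * (radius a y ^ 2 + a ^ 2) * (2 * radius a y * fderiv ℝ (radius a) y w))) /
      ((radius a y ^ 2 + a ^ 2) ^ 2) ^ 2 := by
  have hd := differentiableAt_fderiv_nullCovectorFun_apply hy 2 v
  refine (hd.hasFDerivAt.hasLineDerivAt w).unique ?_
  show HasDerivAt (fun t : ℝ ↦ fderiv ℝ (fun x ↦ nullCovectorFun a x 2) (y + t • w) v) _ 0
  have hfun : (fun t : ℝ ↦ fderiv ℝ (fun x ↦ nullCovectorFun a x 2) (y + t • w) v) =ᶠ[𝓝 0]
      fun t ↦ ((fderiv ℝ (radius a) (y + t • w) v * (y 2 + t * w 2) + radius a (y + t • w) * v 2 - a * v 1) *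
            (radius a (y + t • w) ^ 2 + a ^ 2) -
          (radius a (y + t • w) * (y 2 + t * w 2) - a * (y 1 + t * w 1)) *
            (2 * radius a (y + t • w) * fderiv ℝ (radius a) (y + t • w) v)) /
        (radius a (y + t • w) ^ 2 + a ^ 2) ^ 2 := by
    filter_upwards [eventually_radius_pos_line hy w] with t ht
    rw [fderiv_nullCovectorFun_two ht v, add_smul_apply_E4, add_smul_apply_E4]
  refine HasDerivAt.congr_of_eventuallyEq ?_ hfun
  have hr := hasDerivAt_radius_line hy w
  have hrv := hasDerivAt_fderiv_radius_line hy v w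
  have hl1 := ((hasDerivAt_id (0 : ℝ)).mul_const (w 1)).const_add (y 1)
  have hl2 := ((hasDerivAt_id (0 : ℝ)).mul_const (w 2)).const_add (y 2)
  have hA := ((hrv.mul hl2).add (hr.mul_const (v 2))).sub_const (a * v 1)
  have hP := (hr.pow 2).add_const (a ^ 2)
  have hB := (hr.mul hl2).sub (hl1.const_mul a)
  have hC := (hr.const_mul 2).mul hrv
  have hN := (hA.mul hP).sub (hB.mul hC)
  have hD := hP.pow 2
  have hQ : radius a y ^ 2 + a ^ 2 ≠ 0 := by positivity
  have hD0 : (radius a (y + (0 : ℝ) • w) ^ 2 + a ^ 2) ^ 2 ≠ 0 := by simpa using pow_ne_zero 2 hQ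
  have hdiv := hN.div hD hD0
  refine hdiv.congr_deriv ?_
  simp only [Pi.pow_apply, Pi.mul_apply, Pi.sub_apply, Pi.add_apply, zero_smul, add_zero, zero_mul,
    Nat.cast_ofNat, one_mul, pow_one, Nat.add_one_sub_one, id_eq]

end General

section Tangent

variable {a : ℝ} {y : E4} (h2 : y 2 = a) (h3 : y 3 = 0) (hx : 0 < y 1)
include h2 h3 hx

/-- **Tangent table for `∂²ℓ₁`** at `(t, x, a, 0)`: `∂₂₂ℓ₁ = ∂₃₃ℓ₁ = −1/x²`, all other spatial second
partials vanish. [folklore] -/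
theorem tangent_fderiv_fderiv_nullCovectorFun_one (i j : Fin 3) :
    fderiv ℝ (fun z ↦ fderiv ℝ (fun x ↦ nullCovectorFun a x 1) z (E4.basisVector i.succ)) y
        (E4.basisVector j.succ) =
      ![![0, 0, 0], ![0, -(1 / y 1 ^ 2), 0], ![0, 0, -(1 / y 1 ^ 2)]] i j := by
  have hr0 := tangent_radius_pos h2 h3 hx
  have hr := tangent_radius h2 h3 hx
  have hdr := tangent_fderiv_radius h2 h3 hx
  have hHr := tangent_fderiv_fderiv_radius h2 h3 hx
  have hx0 : y 1 ≠ 0 := hx.ne'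
  have hS : y 1 ^ 2 + a ^ 2 ≠ 0 := by positivity
  rw [fderiv_fderiv_nullCovectorFun_one hr0]
  simp only [hHr, hdr, hr, h2]
  fin_cases i <;> fin_cases j <;> simp [E4.basisVector] <;> field_simp <;>
    first | (left; ring) | ring

/-- **Tangent table for `∂²ℓ₂`** at `(t, x, a, 0)`: `∂₁₂ℓ₂ = ∂₂₁ℓ₂ = −1/x²`, `∂₂₂ℓ₂ = −a/x³`, `∂₃₃ℓ₂ = a/x³`,
all other spatial second partials vanish. [folklore] -/
theorem tangent_fderiv_fderiv_nullCovectorFun_two (i j : Fin 3) :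
    fderiv ℝ (fun z ↦ fderiv ℝ (fun x ↦ nullCovectorFun a x 2) z (E4.basisVector i.succ)) y
        (E4.basisVector j.succ) =
      ![![0, -(1 / y 1 ^ 2), 0], ![-(1 / y 1 ^ 2), -(a / y 1 ^ 3), 0], ![0, 0, a / y 1 ^ 3]] i j := by
  have hr0 := tangent_radius_pos h2 h3 hx
  have hr := tangent_radius h2 h3 hx
  have hdr := tangent_fderiv_radius h2 h3 hx
  have hHr := tangent_fderiv_fderiv_radius h2 h3 hx
  have hx0 : y 1 ≠ 0 := hx.ne'
  have hS : y 1 ^ 2 + a ^ 2 ≠ 0 := by positivity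
  rw [fderiv_fderiv_nullCovectorFun_two hr0]
  simp only [hHr, hdr, hr, h2]
  fin_cases i <;> fin_cases j <;> simp [E4.basisVector] <;> field_simp <;>
    first | (left; ring) | ring

/-- **Tangent table for `∂²ℓ₃`** at `(t, x, a, 0)`: `∂₁₃ℓ₃ = ∂₃₁ℓ₃ = −1/x²`, `∂₂₃ℓ₃ = ∂₃₂ℓ₃ = −a/x³`,
all other spatial second partials vanish. [folklore] -/
theorem tangent_fderiv_fderiv_nullCovectorFun_three (i j : Fin 3) :
    fderiv ℝ (fun z ↦ fderiv ℝ (fun x ↦ nullCovectorFun a x 3) z (E4.basisVector i.succ)) y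
        (E4.basisVector j.succ) =
      ![![0, 0, -(1 / y 1 ^ 2)], ![0, 0, -(a / y 1 ^ 3)], ![-(1 / y 1 ^ 2), -(a / y 1 ^ 3), 0]] i j := by
  have hr0 := tangent_radius_pos h2 h3 hx
  have hr := tangent_radius h2 h3 hx
  have hdr := tangent_fderiv_radius h2 h3 hx
  have hHr := tangent_fderiv_fderiv_radius h2 h3 hx
  have hx0 : y 1 ≠ 0 := hx.ne'
  rw [fderiv_fderiv_nullCovectorFun_three hr0]
  simp only [hHr, hdr, hr, h3]
  fin_cases i <;> fin_cases j <;> simp [E4.basisVector] <;> field_simp <;> ring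

end Tangent

/-- Registered carrier `slaving_nullCovectorHessian_slaving12` of the crux item
(= `tangent_fderiv_fderiv_nullCovectorFun_three`). [folklore] -/
theorem slaving_nullCovectorHessian_slaving12 : open Literature.Geometry.Lorentzian in ∀ {a : ℝ} {y : E4}, y 2 = a → y 3 = 0 → 0 < y 1 → ∀ i j : Fin 3, fderiv ℝ (fun z ↦ fderiv ℝ (fun x ↦ Kerr.nullCovectorFun a x 3) z (E4.basisVector i.succ)) y (E4.basisVector j.succ) = ![![0, 0, -(1 / y 1 ^ 2)], ![0, 0, -(a / y 1 ^ 3)], ![-(1 / y 1 ^ 2), -(a / y 1 ^ 3), 0]] i j :=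
  fun h2 h3 hx i j ↦ tangent_fderiv_fderiv_nullCovectorFun_three h2 h3 hx i j

end Summit.FinalStateConjecture.FinalStateConjecture.Theorems.SublinearIsFree.Slaving
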